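import Literature.NumberTheory.QuadraticForms.HasseMinkowskiRepresentationNumberField
import Literature.NumberTheory.QuadraticForms.LocalQuadraticSpaceClassification
import Literature.NumberTheory.QuadraticForms.HasseMinkowskiRepresentsRat
import HarnessLib

/-!
# Representation of a scalar by a quadratic form over a number field: explicit criteria
# (O'Meara 66:3 with 63:17–63:23, §61; Serre IV §3.2 Cor. 1, §2.2 Cor. to Thm 6)

Topic `NumberTheory/QuadraticForms`; namespace `Literature.NumberTheory.QuadraticForms`. Everything here
is proved. O'Meara, *Introduction to Quadratic Forms*, §66 **66:3** (the local–global principle for the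
representation of a scalar: "`U_𝔭 → V_𝔭` for all `𝔭`" implies "`U → V`", `dim U = 1`; the tree's
`exists_sum_mul_sq_eq_of_forall_place`) made explicit at every spot of a number field `F` for the
tree's nondegenerate diagonal forms `⟨c₁, …, cₙ⟩` and `a ∈ F^*`: at a complex spot every `a` is
represented (`complex_exists_sum_mul_sq_eq`); at a real spot iff some `ρ(cᵢ)` has the sign of `ρ(a)`
(`exists_sum_eq_real_iff`); at a finite spot by Serre's Ch. IV §2.2 Cor. to Thm 6 over the local field
`F_v` (`RegularHilbertFieldIsotropyCriteria.lean` with `isRegularHilbertField_adicCompletion`): always if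
`n ≥ 4`, "`a ≠ -d` or (`a = -d` and `(-1, -d) = ε`)" if `n = 3`, "`(a, -d) = ε`" if `n = 2`.

* `exists_sum_mul_sq_eq_numberField_iff_forall_place` — 66:3 as an equivalence;
* `exists_sum_mul_sq_eq_numberField_iff_of_four_le` — rank `≥ 4`: only the real spots matter;
* `exists_sum_mul_sq_eq_numberField_three_iff`, `exists_sum_mul_sq_eq_numberField_two_iff` — ranks `3`, `2`.

For `F = ℚ` these are `HasseMinkowskiRepresentsRat.lean` (Serre IV §3.2 Cor. 1).

## References

* O. T. O'Meara, *Introduction to Quadratic Forms*, Grundlehren 117, Springer 1963, §66 Thm 66:3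
  (p. 189), §63C, §61 [corpus:book:o-meara1963-introduction-quadratic-forms p0194]. [Omeara1963]
* J.-P. Serre, *A Course in Arithmetic*, GTM 7, Springer 1973, Ch. IV §3.2 Cor. 1 to Thm 8, §2.2 Cor.
  to Thm 6. [Serre1973]
-/

noncomputable section

open Finset NumberField IsDedekindDomain

namespace Literature.NumberTheory.QuadraticForms

/-! ### Transport of representations -/

/-- A representation is transported along a ring homomorphism. [folklore] -/
private theorem exists_sum_mul_sq_eq_map {K L : Type*} [Field K] [Field L] (f : K →+* L) {n : ℕ}
    {c : Fin n → K} {a : K} (h : ∃ x : Fin n → K, ∑ i, c i * x i ^ 2 = a) :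
    ∃ y : Fin n → L, ∑ i, f (c i) * y i ^ 2 = f a := by
  obtain ⟨x, hx⟩ := h
  refine ⟨fun i => f (x i), ?_⟩
  have h' := congrArg f hx
  simpa [map_sum, map_mul, map_pow] using h'

/-- A representation descends along a ring isomorphism. [folklore] -/
private theorem exists_sum_mul_sq_eq_of_ringEquiv {K L : Type*} [Field K] [Field L] (e : K ≃+* L)
    {n : ℕ} {c : Fin n → K} {a : K} (h : ∃ y : Fin n → L, ∑ i, e (c i) * y i ^ 2 = e a) :
    ∃ x : Fin n → K, ∑ i, c i * x i ^ 2 = a := by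
  obtain ⟨y, hy⟩ := h
  refine ⟨fun i => e.symm (y i), e.injective ?_⟩
  simpa [map_sum, map_mul, map_pow] using hy

/-! ### The complex spots -/

/-- **Over `ℂ` a diagonal form with a non-zero coefficient represents every scalar** (O'Meara §61B:
every element of `ℂ` is a square; `a = c_{i₀} w²`). [cite: Omeara1963, §61B p. 155] -/
theorem complex_exists_sum_mul_sq_eq {n : ℕ} {c : Fin n → ℂ} (i₀ : Fin n) (hc : c i₀ ≠ 0) (a : ℂ) :
    ∃ x : Fin n → ℂ, ∑ i, c i * x i ^ 2 = a := by
  classical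
  obtain ⟨w, hw⟩ := IsAlgClosed.exists_eq_mul_self (a / c i₀)
  refine ⟨Pi.single i₀ w, ?_⟩
  rw [Finset.sum_eq_single i₀ (fun j _ hj => by simp [hj]) (by simp)]
  simp only [Pi.single_eq_same]
  rw [sq, ← hw, mul_div_cancel₀ _ hc]

/-! ### O'Meara 66:3 as an equivalence -/

/-- **The local–global principle for the representation of a scalar** (O'Meara 66:3, `dim U = 1`;
Serre IV §3.2 Cor. 1 for `F = ℚ`), as an equivalence: a nondegenerate diagonal form over a number field
`F` represents `a ∈ F^*` iff it does so in every archimedean completion and in every `F_v`.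
[cite: Omeara1963, §66 Thm 66:3 p. 189] -/
theorem exists_sum_mul_sq_eq_numberField_iff_forall_place (F : Type) [Field F] [NumberField F]
    {n : ℕ} (c : Fin n → F) (hc : ∀ i, c i ≠ 0) {a : F} (ha : a ≠ 0) :
    (∃ x : Fin n → F, ∑ i, c i * x i ^ 2 = a) ↔
      (∀ v : InfinitePlace F, ∃ x : Fin n → v.Completion,
          ∑ i, algebraMap F v.Completion (c i) * x i ^ 2 = algebraMap F v.Completion a) ∧
        ∀ v : HeightOneSpectrum (𝓞 F), ∃ x : Fin n → v.adicCompletion F,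
          ∑ i, algebraMap F (v.adicCompletion F) (c i) * x i ^ 2 = algebraMap F (v.adicCompletion F) a :=
  ⟨fun h => ⟨fun _ => exists_sum_mul_sq_eq_map _ h, fun _ => exists_sum_mul_sq_eq_map _ h⟩,
    fun h => exists_sum_mul_sq_eq_of_forall_place F c hc ha h.1 h.2⟩

/-! ### The archimedean spots -/

/-- **The archimedean spots**: if at every real embedding `ρ` some `ρ(cᵢ)` has the sign of `ρ(a)`, then
`⟨c⟩` (`n ≥ 1`, all `cᵢ ≠ 0`) represents `a` in every archimedean completion (real spots: §61A,
`exists_sum_eq_real_iff` through `v.Completion ≃+* ℝ`; complex spots: §61B, no condition).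
[cite: Omeara1963, §61A–B pp. 154–155] -/
theorem exists_sum_mul_sq_eq_infinitePlace (F : Type) [Field F] [NumberField F] {n : ℕ} (hn : 1 ≤ n)
    (c : Fin n → F) (hc : ∀ i, c i ≠ 0) {a : F} (ha : a ≠ 0)
    (hreal : ∀ ρ : F →+* ℝ, ∃ i, 0 < ρ a * ρ (c i)) (v : InfinitePlace F) :
    ∃ x : Fin n → v.Completion,
      ∑ i, algebraMap F v.Completion (c i) * x i ^ 2 = algebraMap F v.Completion a := by
  rcases v.isReal_or_isComplex with hv | hv
  · let e := InfinitePlace.Completion.ringEquivRealOfIsReal hv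
    refine exists_sum_mul_sq_eq_of_ringEquiv e ?_
    have hcR : ∀ i, (e.toRingHom.comp (algebraMap F v.Completion)) (c i) ≠ 0 := fun i =>
      (map_ne_zero _).mpr (hc i)
    have haR : (e.toRingHom.comp (algebraMap F v.Completion)) a ≠ 0 := (map_ne_zero _).mpr ha
    exact (exists_sum_eq_real_iff hcR haR).mpr (hreal _)
  · let e := InfinitePlace.Completion.ringEquivComplexOfIsComplex hv
    refine exists_sum_mul_sq_eq_of_ringEquiv e ?_
    have hc0 : (e.toRingHom.comp (algebraMap F v.Completion)) (c ⟨0, hn⟩) ≠ 0 :=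
      (map_ne_zero _).mpr (hc _)
    exact complex_exists_sum_mul_sq_eq ⟨0, hn⟩ hc0 _

/-! ### Explicit criteria by rank -/

section Criteria

variable (F : Type) [Field F] [NumberField F]

/-- **Rank `≥ 4`: only the real spots matter** (O'Meara 66:3 with 63:18/Serre IV §2.2 Cor. to Thm 6:
over a local field a regular form of rank `≥ 4` is universal): a nondegenerate diagonal form of rank
`n ≥ 4` over a number field represents `a ≠ 0` iff at every real embedding `ρ` some `ρ(cᵢ)` has the
sign of `ρ(a)` (for a totally complex field: always). [cite: Omeara1963, §66 Thm 66:3 p. 189] -/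
theorem exists_sum_mul_sq_eq_numberField_iff_of_four_le {n : ℕ} (hn : 4 ≤ n) (c : Fin n → F)
    (hc : ∀ i, c i ≠ 0) {a : F} (ha : a ≠ 0) :
    (∃ x : Fin n → F, ∑ i, c i * x i ^ 2 = a) ↔ ∀ ρ : F →+* ℝ, ∃ i, 0 < ρ a * ρ (c i) := by
  constructor
  · intro h ρ
    exact (exists_sum_eq_real_iff (fun i => (map_ne_zero ρ).mpr (hc i)) ((map_ne_zero ρ).mpr ha)).mp
      (exists_sum_mul_sq_eq_map ρ h)
  · intro hreal
    refine exists_sum_mul_sq_eq_of_forall_place F c hc ha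
      (exists_sum_mul_sq_eq_infinitePlace F (by omega) c hc ha hreal) fun v => ?_
    exact (isRegularHilbertField_adicCompletion F v).exists_sum_eq_of_four_le
      (exists_three_nonsquares_adicCompletion F v) hn (fun i => (map_ne_zero _).mpr (hc i)) _

/-- **Rank `3`** (O'Meara 66:3 with the local criterion, Serre IV §2.2 Cor. to Thm 6 (iii) over `F_v`:
"`a ≠ -d` or `a = -d` and `(-1, -d) = ε`"): a nondegenerate ternary diagonal form over a number field
represents `a ≠ 0` iff the sign condition holds at every real embedding and, at every finite place
`v`, `-d a ∉ F_v^{*2}` or `(-1, -d)_v = ε_v`. [cite: Omeara1963, §66 Thm 66:3 p. 189] -/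
theorem exists_sum_mul_sq_eq_numberField_three_iff (c : Fin 3 → F) (hc : ∀ i, c i ≠ 0) {a : F}
    (ha : a ≠ 0) :
    (∃ x : Fin 3 → F, ∑ i, c i * x i ^ 2 = a) ↔
      (∀ ρ : F →+* ℝ, ∃ i, 0 < ρ a * ρ (c i)) ∧
        ∀ v : HeightOneSpectrum (𝓞 F),
          ¬ IsSquare (-(∏ i, algebraMap F (v.adicCompletion F) (c i)) *
              algebraMap F (v.adicCompletion F) a) ∨
            hilbertSymbol (v.adicCompletion F) (-1) (-∏ i, algebraMap F (v.adicCompletion F) (c i)) =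
              hasseProd (hilbertSymbol (v.adicCompletion F))
                (fun i => algebraMap F (v.adicCompletion F) (c i)) := by
  have hcv : ∀ (v : HeightOneSpectrum (𝓞 F)) (i), algebraMap F (v.adicCompletion F) (c i) ≠ 0 :=
    fun v i => (map_ne_zero _).mpr (hc i)
  have hav : ∀ v : HeightOneSpectrum (𝓞 F), algebraMap F (v.adicCompletion F) a ≠ 0 := fun v =>
    (map_ne_zero _).mpr ha
  constructor
  · intro h
    refine ⟨fun ρ => (exists_sum_eq_real_iff (fun i => (map_ne_zero ρ).mpr (hc i))
      ((map_ne_zero ρ).mpr ha)).mp (exists_sum_mul_sq_eq_map ρ h), fun v => ?_⟩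
    exact ((isRegularHilbertField_adicCompletion F v).exists_sum_three_eq_iff (hcv v) (hav v)).mp
      (exists_sum_mul_sq_eq_map _ h)
  · rintro ⟨hreal, hfin⟩
    refine exists_sum_mul_sq_eq_of_forall_place F c hc ha
      (exists_sum_mul_sq_eq_infinitePlace F (by norm_num) c hc ha hreal) fun v => ?_
    exact ((isRegularHilbertField_adicCompletion F v).exists_sum_three_eq_iff (hcv v) (hav v)).mpr
      (hfin v)

/-- **Rank `2`** (O'Meara 66:3 with the local criterion, Serre IV §2.2 Cor. to Thm 6 (ii) over `F_v`:
"`(a, -d) = ε`"): a nondegenerate binary diagonal form over a number field represents `a ≠ 0` iff the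
sign condition holds at every real embedding and `(a, -d)_v = ε_v` at every finite place `v`.
[cite: Omeara1963, §66 Thm 66:3 p. 189] -/
theorem exists_sum_mul_sq_eq_numberField_two_iff (c : Fin 2 → F) (hc : ∀ i, c i ≠ 0) {a : F}
    (ha : a ≠ 0) :
    (∃ x : Fin 2 → F, ∑ i, c i * x i ^ 2 = a) ↔
      (∀ ρ : F →+* ℝ, ∃ i, 0 < ρ a * ρ (c i)) ∧
        ∀ v : HeightOneSpectrum (𝓞 F),
          hilbertSymbol (v.adicCompletion F) (algebraMap F (v.adicCompletion F) a)
              (-∏ i, algebraMap F (v.adicCompletion F) (c i)) =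
            hasseProd (hilbertSymbol (v.adicCompletion F))
              (fun i => algebraMap F (v.adicCompletion F) (c i)) := by
  have hcv : ∀ (v : HeightOneSpectrum (𝓞 F)) (i), algebraMap F (v.adicCompletion F) (c i) ≠ 0 :=
    fun v i => (map_ne_zero _).mpr (hc i)
  have hav : ∀ v : HeightOneSpectrum (𝓞 F), algebraMap F (v.adicCompletion F) a ≠ 0 := fun v =>
    (map_ne_zero _).mpr ha
  constructor
  · intro h
    refine ⟨fun ρ => (exists_sum_eq_real_iff (fun i => (map_ne_zero ρ).mpr (hc i))
      ((map_ne_zero ρ).mpr ha)).mp (exists_sum_mul_sq_eq_map ρ h), fun v => ?_⟩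
    exact ((isRegularHilbertField_adicCompletion F v).exists_sum_two_eq_iff (hcv v) (hav v)).mp
      (exists_sum_mul_sq_eq_map _ h)
  · rintro ⟨hreal, hfin⟩
    refine exists_sum_mul_sq_eq_of_forall_place F c hc ha
      (exists_sum_mul_sq_eq_infinitePlace F (by norm_num) c hc ha hreal) fun v => ?_
    exact ((isRegularHilbertField_adicCompletion F v).exists_sum_two_eq_iff (hcv v) (hav v)).mpr
      (hfin v)

end Criteria

end Literature.NumberTheory.QuadraticForms

end
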